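import Literature.AnabelianGeometry.SemiGraphs.FiniteEtaleCoveringCompAssembly
import Literature.AnabelianGeometry.SemiGraphs.BranchAlignedComp
import HarnessLib

/-!
# [SemiAnbd] Rmk. 2.4.1 along finite étale coverings (FACT-LIST F-1478) reduced to the LOCAL clause
# of a composite alone

Mochizuki, *Semi-graphs of anabelioids*, Publ. RIMS **42** (2006) 221–322, §2, Remark 2.4.1 p. 26,
Definition 2.2 (i) p. 23. [cite: MochizukiSemiAnbd2006, Rem. 2.4.1 p.26]

PROOF-ONLY (abc-iut cell, F wave, FACT-LIST row F-1478, assembly seat abc-iut-f-161).  Of the four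
clauses of print's covering notion `Hom.IsFiniteEtaleCoveringGlobal` for a composite `ψ.comp φ`, three
are now kernel theorems for ARBITRARY factors: global (`Hom.IsGlobalCoveringOf.comp_explicit`, f-161),
vertex-aligned (`Hom.IsVertexAligned.comp`, abc-iut-f-160) and branch-aligned
(`Hom.IsBranchAligned.comp`, abc-iut-w5-d177, `BranchAlignedComp.lean` — alignment alone composes).
This file discharges the branch-alignment hypothesis of `FiniteEtaleCoveringCompAssembly.lean`:

* `Hom.isFiniteEtaleCoveringGlobal_comp_of_local` — composites of print's coverings are print's
  coverings, GIVEN ONLY (L): the local description `Hom.IsFiniteEtaleCoveringOf` of the composite over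
  `(α⁻¹ B).left` (for the chosen global datum `(α, e)` of the second factor);
* `remark_2_4_1_covering_of_local_comp` — hence the named fact F-1478 from (L) alone.

Honest framing: (L) is the single outstanding clause (abc-iut-L3-t1, «COMP-LOCAL», via aligned local
data; for an ABSTRACT second factor it rests on the rigidity junction (J1)); typed ≠ proved.  Nothing
here takes a side on [IUTchIII] Cor. 3.12.
-/

namespace Literature.AnabelianGeometry.SemiGraphs

open CategoryTheory CategoryTheory.Limits

universe v₁ u₁ u

namespace SemiGraphOfAnabelioids

/-- **Composites of print's finite étale coverings are print's finite étale coverings, given the local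
clause of the composite.**  The branch-alignment input of `Hom.isFiniteEtaleCoveringGlobal_comp_of` is
discharged by abc-iut-w5-d177's `Hom.IsBranchAligned.comp`.
[cite: MochizukiSemiAnbd2006, Def. 2.2(i) p.23] -/
theorem Hom.isFiniteEtaleCoveringGlobal_comp_of_local
    (hL : ∀ {𝒢 𝒢' 𝒢'' : SemiGraphOfAnabelioids.{v₁, u₁, u}} (ψ : Hom 𝒢'' 𝒢') (φ : Hom 𝒢' 𝒢)
      (B : 𝒢'.BObj) (A : 𝒢.BObj),
      ψ.IsFiniteEtaleCoveringOf B → ψ.IsGlobalCoveringOf B → ψ.IsBranchAligned → ψ.IsVertexAligned →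
      φ.IsFiniteEtaleCoveringOf A → φ.IsBranchAligned → φ.IsVertexAligned →
      ∀ [HasBinaryProducts 𝒢.BObj] (α : Over A ⥤ 𝒢'.BObj) [α.IsEquivalence],
        (φ.pullbackFunctor ≅ Over.star A ⋙ α) →
          (ψ.comp φ).IsFiniteEtaleCoveringOf (α.inv.obj B).left)
    {𝒢 𝒢' 𝒢'' : SemiGraphOfAnabelioids.{v₁, u₁, u}} {ψ : Hom 𝒢'' 𝒢'} {φ : Hom 𝒢' 𝒢}
    (hψ : ψ.IsFiniteEtaleCoveringGlobal) (hφ : φ.IsFiniteEtaleCoveringGlobal) :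
    (ψ.comp φ).IsFiniteEtaleCoveringGlobal :=
  Hom.isFiniteEtaleCoveringGlobal_comp_of hL
    (fun _ _ hψ' hφ' => by
      obtain ⟨_, -, -, hb, -⟩ := hψ'
      obtain ⟨_, -, -, hb', -⟩ := hφ'
      exact hb.comp hb')
    hψ hφ

/-- **[SemiAnbd] Remark 2.4.1 along finite étale coverings (F-1478) from the local clause of composites
alone**: if (L) holds, then `remark_2_4_1_covering` (global, vertex- and branch-alignment of composites
being kernel theorems, and the named fact being reduced to the closure of print's coverings under
composition by `remark_2_4_1_covering_of_comp_isFiniteEtaleCoveringGlobal`).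
[cite: MochizukiSemiAnbd2006, Rem. 2.4.1 p.26] -/
theorem remark_2_4_1_covering_of_local_comp
    (hL : ∀ {𝒢 𝒢' 𝒢'' : SemiGraphOfAnabelioids.{v₁, u₁, u}} (ψ : Hom 𝒢'' 𝒢') (φ : Hom 𝒢' 𝒢)
      (B : 𝒢'.BObj) (A : 𝒢.BObj),
      ψ.IsFiniteEtaleCoveringOf B → ψ.IsGlobalCoveringOf B → ψ.IsBranchAligned → ψ.IsVertexAligned →
      φ.IsFiniteEtaleCoveringOf A → φ.IsBranchAligned → φ.IsVertexAligned →
      ∀ [HasBinaryProducts 𝒢.BObj] (α : Over A ⥤ 𝒢'.BObj) [α.IsEquivalence],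
        (φ.pullbackFunctor ≅ Over.star A ⋙ α) →
          (ψ.comp φ).IsFiniteEtaleCoveringOf (α.inv.obj B).left) :
    Literature.AnabelianGeometry.SemiGraphs.SemiGraphOfAnabelioids.remark_2_4_1_covering.{v₁, u₁, u} :=
  remark_2_4_1_covering_of_comp_isFiniteEtaleCoveringGlobal fun _ _ _ _ _ hψ hφ =>
    Hom.isFiniteEtaleCoveringGlobal_comp_of_local hL hψ hφ

end SemiGraphOfAnabelioids

end Literature.AnabelianGeometry.SemiGraphs
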